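import Mathlib.Analysis.Complex.TaylorSeries
import Mathlib.Analysis.Analytic.OfScalars
import Mathlib.Analysis.Calculus.FDeriv.Analytic
import Mathlib.Analysis.Normed.Ring.InfiniteSum
import Literature.Analysis.TotalPositivity.PolyaFrequencyEntire
import Literature.Analysis.TotalPositivity.PolyaFrequencyDeflation
import HarnessLib

/-!
# Zeros of entire functions with Pólya frequency Taylor coefficients (proved)

Trunk T-ANALYSIS (Literature/Analysis/TotalPositivity). Part C (the analytic half) of the proof of
the `⇒` direction of the named fact `Literature.Analysis.TotalPositivity.pf_taylor_iff_zeros_of_order_lt_one`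
(PolyaFrequency.lean): an ENTIRE function of order `< 1` with real Taylor coefficients, `F(0) > 0`
and Pólya frequency Taylor sequence has only real zeros `≤ 0`. Together with the `⇐` direction
(`isPolyaFrequencySeq_taylor_of_zeros`, PolyaFrequencyEntire.lean) this DISCHARGES
`pf_taylor_iff_zeros_of_order_lt_one` from Hadamard's genus-zero factorisation
(`Literature.Analysis.Complex.hadamard_genus_zero`) alone, without the full Aissen–Schoenberg–Whitney–Edrei
representation `aswe_edrei` (`pf_taylor_iff_zeros_of_order_lt_one_of_hadamard`).

The statement proved is the entire case of the ASWE theorem [Aissen–Edrei–Schoenberg–Whitney 1951,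
Thm. 5: an entire `f = Σ aₙ zⁿ`, `a₀ = 1`, generates a totally positive sequence iff
`f(z) = e^{γz} ∏ (1 + α_ν z)`, `γ, α_ν ≥ 0`, `Σ α_ν < ∞`; Katkova 2006, §1 Thm. C], restricted to
order `< 1` (so `γ = 0`). Only the location of the ZEROS is needed (the "precise information
concerning the nature of the zeros and poles" of [AESW 1951, Thm. 2 and the remark following it],
obtained there by Hadamard's method of polar singularities); Edrei's Nevanlinna-theoretic
contribution (the form of the zero-free factor, [AESW 1951, Thm. 3]) is not needed in genus `0`.

## The argument (elementary; Parts A–B are `PolyaFrequencyDeflation.lean`)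

Write `F(z)/F(0) = ∏ (1 + βₙ z)` (Hadamard), `Σ ‖βₙ‖ < ∞`, and suppose some `β_m ∉ [0, ∞)`.
* C8 (`taylorCoeff_inv_eq_negRecipSeq`): the Taylor sequence at `0` of `g = 1/F(-z) = 1/∏(1 - βₙ z)`
  is `negRecipSeq a`, hence (Part A, `toeplitzMinor_negRecipSeq_consecutive`) COLUMN-POSITIVE
  (`IsColumnPF`: all minors with consecutive columns `≥ 0`).
* C3–C5 (`hasSum_inv_tprod`, `not_summable_of_gt`, `pos_and_ratioLimit_eq`): for `γ` with
  `Σ ‖γₙ‖ < ∞`, `γ ≢ 0`, `M = max ‖γₙ‖ = ‖γ_{n₁}‖`, the Taylor series of `g_γ = 1/∏(1 - γₙ z)`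
  converges on `‖z‖ < 1/M`; if its coefficients `bₙ` are column-positive with `b₀ = 1` they are
  positive with antitone ratios `b_{n+1}/bₙ ↓ ℓ` (Part B), and `ℓ = M`: `ℓ ≤ M` because
  `Σ bₙ rⁿ` converges for `r < 1/M`, and `ℓ ≥ M` because `Σ bₙ rⁿ < ∞` for some `r > 1/M` would
  extend `g_γ` continuously to the closed disc of radius `r`, which contains the pole `1/γ_{n₁}`.
* C6 (`exists_eq_max`, the positivity trick): `(1 - Mz) g_γ(z) = 1 + Σ_{n≥1} (bₙ - M b_{n-1}) zⁿ`
  has non-negative coefficients (Part B's virtual row, `IsColumnPF.mulLinear_neg`), so it is `≥ 1`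
  on `(0, 1/M)`; if no `γₙ` equalled `M` it would tend to `0 · g_γ(1/M) = 0`. Hence some
  `γ_{n₀} = M > 0` is real and positive.
* C7 (`deflation_step`): removing `γ_{n₀}` gives `g_{γ'} = (1 - Mz) g_γ`, whose Taylor sequence
  `(bₙ - M b_{n-1})` is again column-positive with constant term `1`.
* C9 (`nonneg_of_pf_taylor_tprod`): stages are finite sets `S` of removed indices, `γ_S = β` off
  `S` and `0` on `S`, with the Taylor sequence of `g_{γ_S}` column-positive; starting from `S = ∅`
  (C8) each deflation step removes one more index `n₀` with `β_{n₀}` real, positive and of maximal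
  modulus among the remaining ones, so `n₀ ≠ m` and `‖β_{n₀}‖ ≥ ‖β_m‖`; but the set
  `T = {n : ‖βₙ‖ ≥ ‖β_m‖}` is finite (`βₙ → 0`, `β_m ≠ 0`), and `|T| + 1` steps inside `T` are
  impossible.
* C10: `zeros_nonpos_of_pf_taylor` (normalise by `F(0)`, zeros of `∏(1 + βₙ z)` are the `-1/βₙ`)
  and the assembly `pf_taylor_iff_zeros_of_order_lt_one_of_hadamard`.

## Main statements

* `Literature.Analysis.TotalPositivity.nonneg_of_pf_taylor_tprod`: `F = ∏(1 + βₙ z)`, `Σ‖βₙ‖ < ∞`, real PF Taylor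
  sequence `⇒` all `βₙ ∈ [0, ∞)`.
* `Literature.TotalPositivity.zeros_nonpos_of_pf_taylor (hH : hadamard_genus_zero)`: entire of order `< 1`,
  real coefficients, `F(0) > 0`, PF Taylor sequence `⇒` all zeros real `≤ 0`.
* `Literature.TotalPositivity.pf_taylor_iff_zeros_of_order_lt_one_of_hadamard :
  Literature.Complex.hadamard_genus_zero → pf_taylor_iff_zeros_of_order_lt_one`.

## References

* M. Aissen, A. Edrei, I. J. Schoenberg, A. Whitney, *On the generating functions of totally
  positive sequences*, Proc. Nat. Acad. Sci. USA 37 (1951) 303–307, Thms. 2, 5 (p. 305–306).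
* M. Aissen, I. J. Schoenberg, A. M. Whitney, *On the generating functions of totally positive
  sequences I*, J. Analyse Math. 2 (1952) 93–103.
* S. Karlin, *Total Positivity I*, Stanford UP 1968, Ch. 8, Thm. 5.3.
* O. M. Katkova, *Multiple positivity and the Riemann zeta-function*, CMFT 7 (2007) 13–31, §1,
  Thm. ASWE and Thm. C; arXiv:math/0505174.
* S. M. Fallat, C. R. Johnson, *Totally Nonnegative Matrices*, Princeton UP 2011, §0.1
  (pp. 15–16 of the printed book: the representation theorem and the `1/f(-z)` closure rule).
-/

noncomputable section

open Filter Topology Complex Metric Finset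
open scoped Nat NNReal ENNReal

namespace Literature.Analysis.TotalPositivity

/-! ### C1. Power series on a ball: Taylor coefficients are the coefficients -/

/-- A function given on `‖z‖ < r` by a convergent power series `Σ cₙ zⁿ` has that series as its
power series expansion at `0`. [folklore] -/
theorem hasFPowerSeriesOnBall_of_hasSum {h : ℂ → ℂ} {c : ℕ → ℂ} {r : ℝ} (hr : 0 < r)
    (hs : ∀ z : ℂ, ‖z‖ < r → HasSum (fun n => c n * z ^ n) (h z)) :
    HasFPowerSeriesOnBall h (FormalMultilinearSeries.ofScalars ℂ c) 0 (ENNReal.ofReal r) := by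
  set p : FormalMultilinearSeries ℂ ℂ ℂ := FormalMultilinearSeries.ofScalars ℂ c with hp
  have hrad : ENNReal.ofReal r ≤ p.radius := by
    refine ENNReal.le_of_forall_nnreal_lt fun ρ hρ => ?_
    have hρr : (ρ : ℝ) < r := by
      have h1 : ρ < r.toNNReal := ENNReal.coe_lt_coe.1 hρ
      have h2 := NNReal.coe_lt_coe.2 h1
      rwa [Real.coe_toNNReal r hr.le] at h2
    refine p.le_radius_of_tendsto (l := 0) ?_
    have hsum := (hs (ρ : ℂ) (by simpa using hρr)).summable.tendsto_atTop_zero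
    have : (fun n => ‖p n‖ * (ρ : ℝ) ^ n) = fun n => ‖c n * (ρ : ℂ) ^ n‖ := by
      funext n
      simp [hp]
    rw [this]
    exact tendsto_zero_iff_norm_tendsto_zero.1 hsum
  have hr' : (0 : ℝ≥0∞) < ENNReal.ofReal r := by simpa using hr
  have h1 := (p.hasFPowerSeriesOnBall (lt_of_lt_of_le hr' hrad)).mono hr' hrad
  refine h1.congr fun z hz => ?_
  have hz' : ‖z‖ < r := by
    rw [Metric.mem_eball, edist_zero_right, ← ofReal_norm,
      ENNReal.ofReal_lt_ofReal_iff hr] at hz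
    exact hz
  change FormalMultilinearSeries.ofScalarsSum (E := ℂ) c z = h z
  rw [FormalMultilinearSeries.ofScalars_sum_eq]
  simp only [smul_eq_mul]
  exact (hs z hz').tsum_eq

/-- **Uniqueness of Taylor coefficients**: if `h(z) = Σ cₙ zⁿ` for `‖z‖ < r` (`r > 0`), then
`h⁽ⁿ⁾(0) = n! · cₙ`. [folklore] -/
theorem iteratedDeriv_eq_of_hasSum {h : ℂ → ℂ} {c : ℕ → ℂ} {r : ℝ} (hr : 0 < r)
    (hs : ∀ z : ℂ, ‖z‖ < r → HasSum (fun n => c n * z ^ n) (h z)) (n : ℕ) :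
    iteratedDeriv n h 0 = (n ! : ℂ) * c n := by
  have H := (hasFPowerSeriesOnBall_of_hasSum hr hs).factorial_smul 1 n
  rw [iteratedDeriv_eq_iteratedFDeriv, ← H, FormalMultilinearSeries.ofScalars_apply_eq]
  simp [nsmul_eq_mul]

/-- The same, in the normalised form `h⁽ⁿ⁾(0)/n! = cₙ`. [folklore] -/
theorem taylorCoeff_eq_of_hasSum {h : ℂ → ℂ} {c : ℕ → ℂ} {r : ℝ} (hr : 0 < r)
    (hs : ∀ z : ℂ, ‖z‖ < r → HasSum (fun n => c n * z ^ n) (h z)) (n : ℕ) :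
    iteratedDeriv n h 0 / n ! = c n := by
  rw [iteratedDeriv_eq_of_hasSum hr hs n]
  have : (n ! : ℂ) ≠ 0 := by exact_mod_cast n.factorial_ne_zero
  field_simp

/-- Absolute convergence strictly inside the ball of convergence. [folklore] -/
theorem summable_norm_of_hasSum {h : ℂ → ℂ} {c : ℕ → ℂ} {r : ℝ} (hr : 0 < r)
    (hs : ∀ z : ℂ, ‖z‖ < r → HasSum (fun n => c n * z ^ n) (h z)) {z : ℂ} (hz : ‖z‖ < r) :
    Summable fun n => ‖c n * z ^ n‖ := by
  have H := hasFPowerSeriesOnBall_of_hasSum hr hs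
  have hz' : ((‖z‖₊ : ℝ≥0) : ℝ≥0∞) < (FormalMultilinearSeries.ofScalars ℂ c).radius := by
    refine lt_of_lt_of_le ?_ H.r_le
    rw [ENNReal.ofReal_eq_coe_nnreal hr.le, ENNReal.coe_lt_coe]
    exact_mod_cast hz
  have := (FormalMultilinearSeries.ofScalars ℂ c).summable_norm_mul_pow hz'
  refine this.congr fun n => ?_
  simp [norm_pow]

/-- The Taylor series of a function differentiable on `ball 0 r` converges to it there
(Mathlib's `Complex.hasSum_taylorSeries_on_ball`, rearranged). [folklore] -/
theorem hasSum_taylorCoeff_of_differentiableOn {h : ℂ → ℂ} {r : ℝ}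
    (hd : DifferentiableOn ℂ h (ball (0 : ℂ) r)) {z : ℂ} (hz : ‖z‖ < r) :
    HasSum (fun n => (iteratedDeriv n h 0 / n !) * z ^ n) (h z) := by
  have H := Complex.hasSum_taylorSeries_on_ball hd (mem_ball_zero_iff.2 hz)
  simp only [sub_zero, smul_eq_mul] at H
  refine H.congr_fun fun n => ?_
  have : (n ! : ℂ) ≠ 0 := by exact_mod_cast n.factorial_ne_zero
  field_simp

/-! ### C2. Elementary facts on the coefficient sequence `γ` -/

/-- A summable-norm sequence with a non-zero term attains its maximal norm. [folklore] -/
theorem exists_norm_max {γ : ℕ → ℂ} (hγ : Summable fun n => ‖γ n‖) {n₀ : ℕ} (h0 : γ n₀ ≠ 0) :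
    ∃ n₁, γ n₁ ≠ 0 ∧ ∀ n, ‖γ n‖ ≤ ‖γ n₁‖ := by
  have ht : Tendsto (fun n => ‖γ n‖) atTop (𝓝 0) := by
    simpa using hγ.tendsto_atTop_zero
  have hpos : 0 < ‖γ n₀‖ := norm_pos_iff.2 h0
  obtain ⟨N, hN⟩ := eventually_atTop.1 (ht.eventually (gt_mem_nhds hpos))
  -- maximise over `range N ∪ {n₀}`
  obtain ⟨n₁, hn₁, hmax⟩ := Finset.exists_max_image (insert n₀ (Finset.range N)) (fun n => ‖γ n‖)
    ⟨n₀, Finset.mem_insert_self _ _⟩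
  refine ⟨n₁, ?_, fun n => ?_⟩
  · have := hmax n₀ (Finset.mem_insert_self _ _)
    exact norm_pos_iff.1 (lt_of_lt_of_le hpos this)
  · by_cases hn : n < N
    · exact hmax n (Finset.mem_insert_of_mem (Finset.mem_range.2 hn))
    · exact (hN n (not_lt.1 hn)).le.trans (hmax n₀ (Finset.mem_insert_self _ _))

/-- Norm-summability of `-γ`. [folklore] -/
theorem summable_norm_neg {γ : ℕ → ℂ} (hγ : Summable fun n => ‖γ n‖) :
    Summable fun n => ‖-γ n‖ := by simpa using hγ

/-- The product `Q_γ(z) = ∏ (1 - γₙ z)` as an instance of `∏ (1 + cₙ z)`. [folklore] -/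
theorem tprod_one_sub_eq (γ : ℕ → ℂ) (z : ℂ) :
    ∏' n, (1 - γ n * z) = ∏' n, (1 + (-γ n) * z) :=
  tprod_congr fun n => by ring

/-- `Q_γ` is entire. [folklore] -/
theorem differentiable_tprod_one_sub {γ : ℕ → ℂ} (hγ : Summable fun n => ‖γ n‖) :
    Differentiable ℂ fun z => ∏' n, (1 - γ n * z) := by
  have := differentiable_tprod_one_add (summable_norm_neg hγ)
  simpa [tprod_one_sub_eq] using this

/-- `Q_γ(z) ≠ 0` when `‖γₙ‖ · ‖z‖ < 1` for all `n`. [folklore] -/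
theorem tprod_one_sub_ne_zero {γ : ℕ → ℂ} (hγ : Summable fun n => ‖γ n‖) {z : ℂ}
    (hz : ∀ n, ‖γ n‖ * ‖z‖ < 1) : ∏' n, (1 - γ n * z) ≠ 0 := by
  rw [tprod_one_sub_eq]
  refine tprod_one_add_ne_zero_of_summable (fun n h => ?_)
    (by simpa [norm_mul] using hγ.mul_right ‖z‖)
  have : ‖(-γ n) * z‖ = 1 := by
    have h' : (-γ n) * z = -1 := by linear_combination h
    rw [h', norm_neg, norm_one]
  rw [norm_mul, norm_neg] at this
  linarith [hz n]

/-- A vanishing product has a vanishing factor. [folklore] -/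
theorem exists_factor_eq_zero_of_tprod_one_sub_eq_zero {γ : ℕ → ℂ} (hγ : Summable fun n => ‖γ n‖)
    {z : ℂ} (hz : ∏' n, (1 - γ n * z) = 0) : ∃ n, 1 - γ n * z = 0 := by
  rw [tprod_one_sub_eq] at hz
  obtain ⟨n, hn⟩ := exists_factor_eq_zero_of_tprod_eq_zero (summable_norm_neg hγ) hz
  exact ⟨n, by linear_combination hn⟩

/-- Norm-summability is preserved by `Function.update γ n₀ 0`. [folklore] -/
theorem summable_norm_update {γ : ℕ → ℂ} (hγ : Summable fun n => ‖γ n‖) (n₀ : ℕ) :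
    Summable fun n => ‖Function.update γ n₀ 0 n‖ := by
  classical
  refine Summable.of_nonneg_of_le (fun n => norm_nonneg _) (fun n => ?_) hγ
  by_cases hn : n = n₀
  · rw [hn, Function.update_self, norm_zero]; exact norm_nonneg _
  · rw [Function.update_of_ne hn]

/-- Multipliability of `∏ (1 - γₙ z)`. [folklore] -/
theorem multipliable_one_sub {γ : ℕ → ℂ} (hγ : Summable fun n => ‖γ n‖) (z : ℂ) :
    Multipliable fun n => 1 - γ n * z := by
  have := multipliable_one_add_of_summable
    (f := fun n => (-γ n) * z) (by simpa [norm_mul] using hγ.mul_right ‖z‖)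
  exact this.congr fun n => by ring

/-- `HasProd` form of the product. [folklore] -/
theorem hasProd_one_sub {γ : ℕ → ℂ} (hγ : Summable fun n => ‖γ n‖) (z : ℂ) :
    HasProd (fun n => 1 - γ n * z) (∏' n, (1 - γ n * z)) :=
  (multipliable_one_sub hγ z).hasProd

/-- Splitting off one factor: `Q_γ = (1 - γ_{n₀} z) · Q_{γ'}`, `γ' = γ` with `γ'_{n₀} = 0`.
[folklore] -/
theorem tprod_one_sub_eq_mul_update {γ : ℕ → ℂ} (hγ : Summable fun n => ‖γ n‖) (n₀ : ℕ)
    (z : ℂ) : ∏' n, (1 - γ n * z) = (1 - γ n₀ * z) * ∏' n, (1 - Function.update γ n₀ 0 n * z) := by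
  classical
  have hg := multipliable_one_sub (summable_norm_update hγ n₀) z
  have hite : Multipliable fun n : ℕ => if n = n₀ then (1 - γ n₀ * z) else 1 :=
    (hasProd_ite_eq n₀ _).multipliable
  have h1 : (fun n => 1 - γ n * z) =
      fun n => (1 - Function.update γ n₀ 0 n * z) * (if n = n₀ then (1 - γ n₀ * z) else 1) := by
    funext n
    by_cases hn : n = n₀
    · rw [if_pos hn, hn, Function.update_self]; ring
    · rw [if_neg hn, Function.update_of_ne hn]; ring
  calc ∏' n, (1 - γ n * z)
      = ∏' n, ((1 - Function.update γ n₀ 0 n * z) * (if n = n₀ then (1 - γ n₀ * z) else 1)) := by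
        rw [h1]
    _ = (∏' n, (1 - Function.update γ n₀ 0 n * z)) *
          ∏' n : ℕ, (if n = n₀ then (1 - γ n₀ * z) else 1) := hg.tprod_mul hite
    _ = _ := by rw [tprod_ite_eq, mul_comm]

/-! ### C3. The stage: Taylor series of `g = 1/Q_γ` on the disc `‖z‖ < 1/max ‖γₙ‖` -/

/-- `Q_γ ≠ 0` on the disc `‖z‖ < 1/M`, `M = max ‖γₙ‖`. [folklore] -/
theorem tprod_one_sub_ne_zero_of_norm_lt {γ : ℕ → ℂ} (hγ : Summable fun n => ‖γ n‖) {n₁ : ℕ}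
    (hmax : ∀ n, ‖γ n‖ ≤ ‖γ n₁‖) (h1 : γ n₁ ≠ 0) {z : ℂ} (hz : ‖z‖ < ‖γ n₁‖⁻¹) :
    ∏' n, (1 - γ n * z) ≠ 0 := by
  have hM : 0 < ‖γ n₁‖ := norm_pos_iff.2 h1
  refine tprod_one_sub_ne_zero hγ fun n => ?_
  calc ‖γ n‖ * ‖z‖ ≤ ‖γ n₁‖ * ‖z‖ := mul_le_mul_of_nonneg_right (hmax n) (norm_nonneg _)
    _ < ‖γ n₁‖ * ‖γ n₁‖⁻¹ := mul_lt_mul_of_pos_left hz hM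
    _ = 1 := mul_inv_cancel₀ hM.ne'

/-- `g = 1/Q_γ` is differentiable on the disc `‖z‖ < 1/M`. [folklore] -/
theorem differentiableOn_inv_tprod {γ : ℕ → ℂ} (hγ : Summable fun n => ‖γ n‖) {n₁ : ℕ}
    (hmax : ∀ n, ‖γ n‖ ≤ ‖γ n₁‖) (h1 : γ n₁ ≠ 0) :
    DifferentiableOn ℂ (fun z => (∏' n, (1 - γ n * z))⁻¹) (ball (0 : ℂ) ‖γ n₁‖⁻¹) := fun z hz =>
  (((differentiable_tprod_one_sub hγ) z).inv
    (tprod_one_sub_ne_zero_of_norm_lt hγ hmax h1 (mem_ball_zero_iff.1 hz))).differentiableWithinAt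

/-- **Taylor series of `g` on the disc.** If the Taylor coefficients of `g = 1/Q_γ` at `0` are the
real numbers `bₙ`, then `g(z) = Σ bₙ zⁿ` for `‖z‖ < 1/M`. [folklore] -/
theorem hasSum_inv_tprod {γ : ℕ → ℂ} (hγ : Summable fun n => ‖γ n‖) {n₁ : ℕ}
    (hmax : ∀ n, ‖γ n‖ ≤ ‖γ n₁‖) (h1 : γ n₁ ≠ 0) {b : ℕ → ℝ}
    (hb : ∀ n, iteratedDeriv n (fun z => (∏' k, (1 - γ k * z))⁻¹) 0 / n ! = b n) {z : ℂ}
    (hz : ‖z‖ < ‖γ n₁‖⁻¹) :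
    HasSum (fun n => (b n : ℂ) * z ^ n) ((∏' k, (1 - γ k * z))⁻¹) := by
  have := hasSum_taylorCoeff_of_differentiableOn (differentiableOn_inv_tprod hγ hmax h1) hz
  simpa only [hb] using this

/-- **No convergence beyond the pole.** With `bₙ ≥ 0` the Taylor coefficients of `g = 1/Q_γ`, the
real series `Σ bₙ rⁿ` diverges for every `r > 1/M`: otherwise `Σ bₙ zⁿ` would extend `g`
continuously to the closed disc of radius `r`, which contains the pole `z₀ = 1/γ_{n₁}` of `g`.
(Cf. [Aissen–Schoenberg–Whitney 1952, §3]; the Vivanti–Pringsheim circle of ideas.) [folklore] -/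
theorem not_summable_of_gt {γ : ℕ → ℂ} (hγ : Summable fun n => ‖γ n‖) {n₁ : ℕ}
    (hmax : ∀ n, ‖γ n‖ ≤ ‖γ n₁‖) (h1 : γ n₁ ≠ 0) {b : ℕ → ℝ} (hb0 : ∀ n, 0 ≤ b n)
    (hb : ∀ n, iteratedDeriv n (fun z => (∏' k, (1 - γ k * z))⁻¹) 0 / n ! = b n) {r : ℝ}
    (hr : ‖γ n₁‖⁻¹ < r) : ¬ Summable fun n => b n * r ^ n := by
  intro hs
  have hM : 0 < ‖γ n₁‖ := norm_pos_iff.2 h1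
  set c : ℝ := ‖γ n₁‖⁻¹ with hc
  have hc0 : 0 < c := inv_pos.2 hM
  have hr0 : 0 < r := hc0.trans hr
  -- the pole
  set z₀ : ℂ := (γ n₁)⁻¹ with hz₀
  have hz₀n : ‖z₀‖ = c := by rw [hz₀, norm_inv]
  have hQz₀ : ∏' k, (1 - γ k * z₀) = 0 := by
    have h : HasProd (fun k => 1 - γ k * z₀) 0 :=
      hasProd_zero_of_exists_eq_zero ⟨n₁, by rw [hz₀, mul_inv_cancel₀ h1, sub_self]⟩
    exact (hasProd_one_sub hγ z₀).unique h
  -- the continuous extension `G`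
  set G : ℂ → ℂ := fun z => ∑' n, (b n : ℂ) * z ^ n with hG
  have hGcont : ContinuousOn G (closedBall (0 : ℂ) r) := by
    refine continuousOn_tsum (fun n => (Continuous.continuousOn (by fun_prop))) hs fun n z hz => ?_
    rw [mem_closedBall_zero_iff] at hz
    rw [norm_mul, norm_pow, Complex.norm_real, Real.norm_of_nonneg (hb0 n)]
    exact mul_le_mul_of_nonneg_left (pow_le_pow_left₀ (norm_nonneg _) hz n) (hb0 n)
  have hGg : ∀ z : ℂ, ‖z‖ < c → G z = (∏' k, (1 - γ k * z))⁻¹ := fun z hz =>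
    (hasSum_inv_tprod hγ hmax h1 hb hz).tsum_eq
  -- the path `t ↦ t z₀`, `t → 1⁻`
  have hpath : Tendsto (fun t : ℝ => (t : ℂ) * z₀) (𝓝[<] 1) (𝓝[closedBall (0 : ℂ) r] z₀) := by
    refine tendsto_nhdsWithin_iff.2 ⟨?_, ?_⟩
    · have hcont : Continuous fun t : ℝ => (t : ℂ) * z₀ :=
        Complex.continuous_ofReal.mul continuous_const
      have : Tendsto (fun t : ℝ => (t : ℂ) * z₀) (𝓝 1) (𝓝 z₀) := by
        have h := hcont.tendsto (1 : ℝ)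
        rwa [Complex.ofReal_one, one_mul] at h
      exact this.mono_left nhdsWithin_le_nhds
    · have hev : ∀ᶠ t : ℝ in 𝓝[<] 1, 0 < t := by
        have : ∀ᶠ t : ℝ in 𝓝 (1 : ℝ), 0 < t := lt_mem_nhds one_pos
        exact nhdsWithin_le_nhds this
      filter_upwards [hev, self_mem_nhdsWithin] with t ht0 ht1
      rw [Set.mem_Iio] at ht1
      rw [mem_closedBall_zero_iff, norm_mul, Complex.norm_real, Real.norm_of_nonneg ht0.le, hz₀n]
      nlinarith
  have hlimG : Tendsto (fun t : ℝ => G ((t : ℂ) * z₀)) (𝓝[<] 1) (𝓝 (G z₀)) :=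
    (hGcont z₀ (by rw [mem_closedBall_zero_iff, hz₀n]; exact hr.le)).tendsto.comp hpath
  have hlimQ : Tendsto (fun t : ℝ => ∏' k, (1 - γ k * ((t : ℂ) * z₀))) (𝓝[<] 1) (𝓝 0) := by
    rw [← hQz₀]
    have hcQ := (differentiable_tprod_one_sub hγ).continuous
    have : Tendsto (fun t : ℝ => (t : ℂ) * z₀) (𝓝[<] 1) (𝓝 z₀) :=
      (tendsto_nhdsWithin_iff.1 hpath).1
    exact (hcQ.tendsto z₀).comp this
  have hlim0 : Tendsto (fun t : ℝ => G ((t : ℂ) * z₀) * ∏' k, (1 - γ k * ((t : ℂ) * z₀)))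
      (𝓝[<] 1) (𝓝 (G z₀ * 0)) := hlimG.mul hlimQ
  rw [mul_zero] at hlim0
  -- but the product is `1` for `t ∈ (0, 1)`
  have hev1 : ∀ᶠ t : ℝ in 𝓝[<] 1,
      G ((t : ℂ) * z₀) * ∏' k, (1 - γ k * ((t : ℂ) * z₀)) = 1 := by
    have hev : ∀ᶠ t : ℝ in 𝓝[<] 1, 0 < t := by
      have : ∀ᶠ t : ℝ in 𝓝 (1 : ℝ), 0 < t := lt_mem_nhds one_pos
      exact nhdsWithin_le_nhds this
    filter_upwards [hev, self_mem_nhdsWithin] with t ht0 ht1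
    rw [Set.mem_Iio] at ht1
    have hzt : ‖(t : ℂ) * z₀‖ < c := by
      rw [norm_mul, Complex.norm_real, Real.norm_of_nonneg ht0.le, hz₀n]
      nlinarith
    rw [hGg _ hzt, inv_mul_cancel₀ (tprod_one_sub_ne_zero_of_norm_lt hγ hmax h1 hzt)]
  have hlim1 : Tendsto (fun t : ℝ => G ((t : ℂ) * z₀) * ∏' k, (1 - γ k * ((t : ℂ) * z₀)))
      (𝓝[<] 1) (𝓝 1) := tendsto_const_nhds.congr' (hev1.mono fun t ht => ht.symm)
  exact zero_ne_one (tendsto_nhds_unique hlim0 hlim1)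

/-! ### C5. Positivity of the coefficients and the ratio limit `ℓ = max ‖γₙ‖` -/

/-- Real summability of `Σ bₙ rⁿ` for `0 ≤ r < 1/M` (from the complex Taylor series). [folklore] -/
theorem summable_mul_pow_of_lt {γ : ℕ → ℂ} (hγ : Summable fun n => ‖γ n‖) {n₁ : ℕ}
    (hmax : ∀ n, ‖γ n‖ ≤ ‖γ n₁‖) (h1 : γ n₁ ≠ 0) {b : ℕ → ℝ}
    (hb : ∀ n, iteratedDeriv n (fun z => (∏' k, (1 - γ k * z))⁻¹) 0 / n ! = b n) {r : ℝ}
    (hr0 : 0 ≤ r) (hr : r < ‖γ n₁‖⁻¹) : Summable fun n => b n * r ^ n := by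
  have hz : ‖(r : ℂ)‖ < ‖γ n₁‖⁻¹ := by
    rw [Complex.norm_real, Real.norm_of_nonneg hr0]; exact hr
  have h := (hasSum_inv_tprod hγ hmax h1 hb hz).summable
  have := (Complex.hasSum_re h.hasSum).summable
  refine this.congr fun n => ?_
  rw [← Complex.ofReal_pow, ← Complex.ofReal_mul, Complex.ofReal_re]

/-- **Positivity and the ratio limit.** For a column-positive `b` (`b₀ = 1`) which is the Taylor
sequence of `g = 1/Q_γ` (`γ ≢ 0`, `M = max ‖γₙ‖ = ‖γ_{n₁}‖`): all `bₙ > 0` and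
`lim b_{n+1}/bₙ = M`. [Aissen–Schoenberg–Whitney 1952, §3] [folklore] -/
theorem pos_and_ratioLimit_eq {γ : ℕ → ℂ} (hγ : Summable fun n => ‖γ n‖) {n₁ : ℕ}
    (hmax : ∀ n, ‖γ n‖ ≤ ‖γ n₁‖) (h1 : γ n₁ ≠ 0) {b : ℕ → ℝ} (hcol : IsColumnPF b) (h0 : b 0 = 1)
    (hb : ∀ n, iteratedDeriv n (fun z => (∏' k, (1 - γ k * z))⁻¹) 0 / n ! = b n) :
    (∀ n, 0 < b n) ∧ ratioLimit b = ‖γ n₁‖ := by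
  have hM : 0 < ‖γ n₁‖ := norm_pos_iff.2 h1
  set c : ℝ := ‖γ n₁‖⁻¹ with hc
  have hc0 : 0 < c := inv_pos.2 hM
  have hb0 : ∀ n, 0 ≤ b n := hcol.nonneg
  -- not eventually zero
  have hne : ∀ N, ∃ n, N ≤ n ∧ b n ≠ 0 := by
    intro N
    by_contra hcon
    push Not at hcon
    refine not_summable_of_gt hγ hmax h1 hb0 hb (r := c + 1) (by linarith) ?_
    refine summable_of_ne_finset_zero (s := Finset.range N) fun n hn => ?_
    rw [Finset.mem_range, not_lt] at hn
    rw [hcon n hn, zero_mul]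
  have hpos : ∀ n, 0 < b n := hcol.pos (by rw [h0]; exact one_pos) hne
  refine ⟨hpos, le_antisymm ?_ ?_⟩
  · -- `ℓ ≤ M`: otherwise the lower bound `bₙ ≥ ℓⁿ` contradicts convergence at some `r < c`
    by_contra hlt
    push Not at hlt
    have hℓ0 : 0 < ratioLimit b := hM.trans hlt
    obtain ⟨r, hr1, hr2⟩ := exists_between (show (ratioLimit b)⁻¹ < c from by
      rw [hc]; exact (inv_lt_inv₀ hℓ0 hM).2 hlt)
    have hr0 : 0 < r := (inv_pos.2 hℓ0).trans hr1
    have hs := summable_mul_pow_of_lt hγ hmax h1 hb hr0.le hr2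
    have ht := hs.tendsto_atTop_zero
    -- `(ℓ r)ⁿ ≤ bₙ rⁿ → 0` with `ℓ r > 1`
    have hℓr : 1 < ratioLimit b * r := by
      have := (inv_lt_iff_one_lt_mul₀ hℓ0).1 hr1
      linarith [this]
    have hge : ∀ n, (ratioLimit b * r) ^ n ≤ b n * r ^ n := fun n => by
      rw [mul_pow]
      have := hcol.pow_ratioLimit_le hpos n
      rw [h0, mul_one] at this
      exact mul_le_mul_of_nonneg_right this (pow_nonneg hr0.le n)
    have h1le : ∀ n, (1 : ℝ) ≤ b n * r ^ n := fun n =>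
      (one_le_pow₀ hℓr.le).trans (hge n)
    have := ht.eventually (gt_mem_nhds one_pos)
    obtain ⟨N, hN⟩ := eventually_atTop.1 this
    exact absurd (hN N le_rfl) (not_lt.2 (h1le N))
  · -- `M ≤ ℓ`: otherwise `bₙ ≤ C (ℓ+ε)ⁿ` gives convergence beyond `c`
    by_contra hlt
    push Not at hlt
    set ε : ℝ := (‖γ n₁‖ - ratioLimit b) / 2 with hε
    have hε0 : 0 < ε := by rw [hε]; linarith
    obtain ⟨C, n₀, hC, hbnd⟩ := hcol.exists_le_pow hpos hε0
    have hq0 : 0 < ratioLimit b + ε := by linarith [hcol.ratioLimit_nonneg hpos]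
    have hq : ratioLimit b + ε < ‖γ n₁‖ := by rw [hε]; linarith
    obtain ⟨r, hr1, hr2⟩ := exists_between (show c < (ratioLimit b + ε)⁻¹ from by
      rw [hc]; exact (inv_lt_inv₀ hM hq0).2 hq)
    have hr0 : 0 < r := hc0.trans hr1
    refine not_summable_of_gt hγ hmax h1 hb0 hb hr1 ?_
    have hgeom : Summable fun n => C * ((ratioLimit b + ε) * r) ^ n := by
      refine (summable_geometric_of_lt_one (mul_nonneg hq0.le hr0.le) ?_).mul_left C
      have := (lt_inv_comm₀ hr0 hq0).1 hr2
      calc (ratioLimit b + ε) * r < r⁻¹ * r := mul_lt_mul_of_pos_right this hr0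
        _ = 1 := inv_mul_cancel₀ hr0.ne'
    refine Summable.of_norm_bounded_eventually_nat hgeom ?_
    filter_upwards [eventually_ge_atTop n₀] with n hn
    rw [Real.norm_of_nonneg (mul_nonneg (hb0 n) (pow_nonneg hr0.le n)), mul_pow, ← mul_assoc]
    exact mul_le_mul_of_nonneg_right (hbnd n hn) (pow_nonneg hr0.le n)

/-! ### C6. The positivity trick: `Q_γ(1/ℓ) = 0`, so some `γ_{n₀} = ℓ` is real and positive -/

/-- Multiplying a power series by `1 + α z`: coefficients `mulLinear`. [folklore] -/
theorem hasSum_mulLinear {a : ℕ → ℝ} {z s : ℂ} (h : HasSum (fun n => (a n : ℂ) * z ^ n) s)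
    (α : ℝ) : HasSum (fun n => (mulLinear a α n : ℂ) * z ^ n) ((1 + α * z) * s) := by
  -- the shifted series `Σ a_{n-1} zⁿ = z · s`
  have h1 : HasSum (fun n : ℕ => (seqZ a ((n : ℤ) - 1) : ℂ) * z ^ n) (z * s) := by
    have h2 : HasSum (fun n : ℕ => (seqZ a (((n + 1 : ℕ) : ℤ) - 1) : ℂ) * z ^ (n + 1)) (z * s) := by
      have := h.mul_left z
      refine this.congr_fun fun n => ?_
      have e : (((n + 1 : ℕ) : ℤ) - 1) = (n : ℕ) := by push_cast; ring
      rw [e, seqZ_natCast]; ring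
    have h3 := (hasSum_nat_add_iff' (f := fun n : ℕ => (seqZ a ((n : ℤ) - 1) : ℂ) * z ^ n) 1
      (g := z * s)).1
    simp only [Finset.range_one, Finset.sum_singleton, Nat.cast_zero, zero_sub, pow_zero,
      mul_one] at h3
    rw [seqZ_of_neg a (by norm_num), Complex.ofReal_zero, sub_zero] at h3
    exact h3 h2
  have := h.add (h1.mul_left (α : ℂ))
  convert this using 1
  · funext n
    rw [mulLinear]; push_cast; ring
  · ring

/-- The deflated coefficients are non-negative: `bₙ - ℓ b_{n-1} ≥ 0`. [folklore] -/
theorem mulLinear_neg_ratioLimit_nonneg {b : ℕ → ℝ} (hcol : IsColumnPF b) (hpos : ∀ n, 0 < b n)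
    (n : ℕ) : 0 ≤ mulLinear b (-ratioLimit b) n := by
  cases n with
  | zero => rw [mulLinear_zero]; exact (hpos 0).le
  | succ n =>
    rw [mulLinear_succ]
    have := hcol.ratioLimit_le hpos n
    rw [le_div_iff₀ (hpos n)] at this
    linarith

/-- **The pole is on the positive axis.** In the situation of `pos_and_ratioLimit_eq`,
`Q_γ(1/M) = 0`; hence some `γ_{n₀}` equals `M = max ‖γₙ‖ > 0` (real and positive). Proof:
`(1 - Mz) g(z) = Σ (bₙ - M b_{n-1}) zⁿ` has non-negative coefficients and constant term `1`, so its
real part is `≥ 1` on `(0, 1/M)`, while it would tend to `(1 - 1) g(1/M) = 0` at `z = 1/M` if `g`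
were continuous there. [Aissen–Schoenberg–Whitney 1952, §3] [folklore] -/
theorem exists_eq_max {γ : ℕ → ℂ} (hγ : Summable fun n => ‖γ n‖) {n₁ : ℕ}
    (hmax : ∀ n, ‖γ n‖ ≤ ‖γ n₁‖) (h1 : γ n₁ ≠ 0) {b : ℕ → ℝ} (hcol : IsColumnPF b) (h0 : b 0 = 1)
    (hb : ∀ n, iteratedDeriv n (fun z => (∏' k, (1 - γ k * z))⁻¹) 0 / n ! = b n) :
    ∃ n₀, γ n₀ = (‖γ n₁‖ : ℂ) := by
  obtain ⟨hpos, hℓ⟩ := pos_and_ratioLimit_eq hγ hmax h1 hcol h0 hb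
  have hM : 0 < ‖γ n₁‖ := norm_pos_iff.2 h1
  set M : ℝ := ‖γ n₁‖ with hMdef
  set c : ℝ := M⁻¹ with hc
  have hc0 : 0 < c := inv_pos.2 hM
  -- it suffices that `Q_γ(c) = 0`
  suffices hQ : ∏' k, (1 - γ k * (c : ℂ)) = 0 by
    obtain ⟨n₀, hn₀⟩ := exists_factor_eq_zero_of_tprod_one_sub_eq_zero hγ hQ
    refine ⟨n₀, ?_⟩
    have hc' : (c : ℂ) ≠ 0 := by exact_mod_cast hc0.ne'
    have hmul : γ n₀ * c = 1 := by linear_combination -hn₀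
    have : γ n₀ = (c : ℂ)⁻¹ := by
      calc γ n₀ = γ n₀ * c * (c : ℂ)⁻¹ := (mul_inv_cancel_right₀ hc' _).symm
        _ = (c : ℂ)⁻¹ := by rw [hmul, one_mul]
    rw [this, hc, Complex.ofReal_inv, inv_inv]
  by_contra hQ
  -- `g` is continuous at `c`
  set g : ℂ → ℂ := fun z => (∏' k, (1 - γ k * z))⁻¹ with hg
  have hgc : ContinuousAt g (c : ℂ) :=
    (((differentiable_tprod_one_sub hγ).continuous.continuousAt).inv₀ hQ)
  -- `h(r) := (1 - M r) g(r)` tends to `0` as `r → c`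
  set h : ℝ → ℂ := fun r => (1 + ((-M : ℝ) : ℂ) * (r : ℂ)) * g r with hh
  have hlim0 : Tendsto h (𝓝[<] c) (𝓝 0) := by
    have h1' : Tendsto (fun r : ℝ => (r : ℂ)) (𝓝 c) (𝓝 (c : ℂ)) :=
      Complex.continuous_ofReal.tendsto c
    have hg' : Tendsto (fun r : ℝ => g r) (𝓝 c) (𝓝 (g c)) := hgc.tendsto.comp h1'
    have hlin : Tendsto (fun r : ℝ => (1 + ((-M : ℝ) : ℂ) * (r : ℂ))) (𝓝 c)
        (𝓝 (1 + ((-M : ℝ) : ℂ) * (c : ℂ))) :=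
      tendsto_const_nhds.add (tendsto_const_nhds.mul h1')
    have hzero : (1 + ((-M : ℝ) : ℂ) * (c : ℂ)) = 0 := by
      have hM' : (M : ℂ) ≠ 0 := by exact_mod_cast hM.ne'
      rw [hc]; push_cast
      rw [neg_mul, mul_inv_cancel₀ hM']; ring
    have := hlin.mul hg'
    rw [hzero, zero_mul] at this
    exact this.mono_left nhdsWithin_le_nhds
  -- but `re h(r) ≥ 1` for `0 < r < c`
  have hge : ∀ᶠ r in 𝓝[<] c, (1 : ℝ) ≤ (h r).re := by
    have hev : ∀ᶠ r : ℝ in 𝓝[<] c, 0 < r := nhdsWithin_le_nhds (lt_mem_nhds hc0)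
    filter_upwards [hev, self_mem_nhdsWithin] with r hr0 hrc
    rw [Set.mem_Iio] at hrc
    have hz : ‖(r : ℂ)‖ < ‖γ n₁‖⁻¹ := by
      rw [Complex.norm_real, Real.norm_of_nonneg hr0.le]; exact hrc
    have hs := hasSum_mulLinear (hasSum_inv_tprod hγ hmax h1 hb hz) (-M)
    have hsre := Complex.hasSum_re hs
    have hterm : ∀ n, ((mulLinear b (-M) n : ℂ) * (r : ℂ) ^ n).re = mulLinear b (-M) n * r ^ n :=
      fun n => by rw [← Complex.ofReal_pow, ← Complex.ofReal_mul, Complex.ofReal_re]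
    simp only [hterm] at hsre
    have hnn : ∀ n, 0 ≤ mulLinear b (-M) n * r ^ n := fun n =>
      mul_nonneg (by rw [← hℓ]; exact mulLinear_neg_ratioLimit_nonneg hcol hpos n)
        (pow_nonneg hr0.le n)
    have := le_hasSum hsre 0 fun n _ => hnn n
    rw [pow_zero, mul_one, mulLinear_zero, h0] at this
    exact this
  have hlimre : Tendsto (fun r => (h r).re) (𝓝[<] c) (𝓝 0) := by
    have := (Complex.continuous_re.tendsto 0).comp hlim0
    rwa [Complex.zero_re] at this
  have := ge_of_tendsto hlimre hge
  norm_num at this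

/-! ### C7. The deflation step -/

/-- **One deflation step.** If `b` (column-positive, `b₀ = 1`) is the Taylor sequence of
`1/Q_γ` with `γ ≢ 0`, then there is `n₀` with `γ_{n₀} = M := max ‖γₙ‖ > 0` (real, positive),
and `b̃ = (bₙ - M b_{n-1})ₙ` (again column-positive with `b̃₀ = 1`) is the Taylor sequence of
`1/Q_{γ'}`, `γ' = γ` with the `n₀`-th term removed. [Aissen–Schoenberg–Whitney 1952, §3]
[folklore] -/
theorem deflation_step {γ : ℕ → ℂ} (hγ : Summable fun n => ‖γ n‖) {n₁ : ℕ}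
    (hmax : ∀ n, ‖γ n‖ ≤ ‖γ n₁‖) (h1 : γ n₁ ≠ 0) {b : ℕ → ℝ} (hcol : IsColumnPF b) (h0 : b 0 = 1)
    (hb : ∀ n, iteratedDeriv n (fun z => (∏' k, (1 - γ k * z))⁻¹) 0 / n ! = b n) :
    ∃ n₀, γ n₀ = (‖γ n₁‖ : ℂ) ∧
      IsColumnPF (mulLinear b (-‖γ n₁‖)) ∧ mulLinear b (-‖γ n₁‖) 0 = 1 ∧
      ∀ n, iteratedDeriv n (fun z => (∏' k, (1 - Function.update γ n₀ 0 k * z))⁻¹) 0 / n ! =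
        (mulLinear b (-‖γ n₁‖) n : ℝ) := by
  obtain ⟨hpos, hℓ⟩ := pos_and_ratioLimit_eq hγ hmax h1 hcol h0 hb
  obtain ⟨n₀, hn₀⟩ := exists_eq_max hγ hmax h1 hcol h0 hb
  have hM : 0 < ‖γ n₁‖ := norm_pos_iff.2 h1
  refine ⟨n₀, hn₀, ?_, by rw [mulLinear_zero, h0], ?_⟩
  · rw [← hℓ]
    exact hcol.mulLinear_neg hpos (hcol.tendsto_ratio_pow hpos)
  · refine taylorCoeff_eq_of_hasSum (inv_pos.2 hM) fun z hz => ?_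
    have hs := hasSum_mulLinear (hasSum_inv_tprod hγ hmax h1 hb hz) (-‖γ n₁‖)
    have hQ : ∏' k, (1 - γ k * z) ≠ 0 := tprod_one_sub_ne_zero_of_norm_lt hγ hmax h1 hz
    rw [tprod_one_sub_eq_mul_update hγ n₀ z, hn₀] at hQ
    have hlin : (1 - (‖γ n₁‖ : ℂ) * z) ≠ 0 := left_ne_zero_of_mul hQ
    have hQ' : ∏' k, (1 - Function.update γ n₀ 0 k * z) ≠ 0 := right_ne_zero_of_mul hQ
    convert hs using 1
    rw [tprod_one_sub_eq_mul_update hγ n₀ z, hn₀, mul_inv, ← mul_assoc]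
    push_cast
    rw [show (1 + -(‖γ n₁‖ : ℂ) * z) = 1 - (‖γ n₁‖ : ℂ) * z by ring, mul_inv_cancel₀ hlin, one_mul]

/-! ### C8. The initial stage: the Taylor sequence of `1/F(-z)` is `negRecipSeq a` -/

/-- Uniqueness for the convolution recursion `Σ_{k ≤ n} u_k x_{n-k} = δ_{n,0}` (`u₀ = 1`).
[folklore] -/
theorem conv_unique {u x y : ℕ → ℂ} (hu : u 0 = 1)
    (hx : ∀ n, ∑ k ∈ Finset.range (n + 1), u k * x (n - k) = if n = 0 then 1 else 0)
    (hy : ∀ n, ∑ k ∈ Finset.range (n + 1), u k * y (n - k) = if n = 0 then 1 else 0) :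
    x = y := by
  funext n
  induction n using Nat.strong_induction_on with
  | _ n ih =>
    have h1 := hx n
    have h2 := hy n
    rw [Finset.sum_range_succ', hu, Nat.sub_zero, one_mul] at h1 h2
    have : ∑ k ∈ Finset.range n, u (k + 1) * x (n - (k + 1)) =
        ∑ k ∈ Finset.range n, u (k + 1) * y (n - (k + 1)) :=
      Finset.sum_congr rfl fun k hk => by
        rw [Finset.mem_range] at hk
        rw [ih (n - (k + 1)) (by omega)]
    rw [this] at h1
    linear_combination h1 - h2

/-- **The initial stage.** Let `F(z) = ∏ (1 + βₙ z)` (`Σ ‖βₙ‖ < ∞`) have real Taylor sequence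
`a` at `0`. Then the Taylor sequence of `g(z) = 1/F(-z) = 1/∏(1 - βₙ z)` at `0` is
`negRecipSeq a` (the reciprocal power series). [Aissen–Schoenberg–Whitney 1952, §2] [folklore] -/
theorem taylorCoeff_inv_eq_negRecipSeq {β : ℕ → ℂ} (hβ : Summable fun n => ‖β n‖) {a : ℕ → ℝ}
    (ha : ∀ n, iteratedDeriv n (fun z => ∏' k, (1 + β k * z)) 0 / n ! = a n) (n : ℕ) :
    iteratedDeriv n (fun z => (∏' k, (1 - β k * z))⁻¹) 0 / n ! = (negRecipSeq a n : ℝ) := by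
  -- the radius `ρ₀`
  set σ : ℝ := ∑' k, ‖β k‖ with hσ
  have hσ0 : 0 ≤ σ := tsum_nonneg fun k => norm_nonneg _
  set ρ₀ : ℝ := (σ + 1)⁻¹ with hρ₀
  have hρ₀0 : 0 < ρ₀ := inv_pos.2 (by linarith)
  have hne : ∀ z : ℂ, ‖z‖ < ρ₀ → ∏' k, (1 - β k * z) ≠ 0 := by
    intro z hz
    refine tprod_one_sub_ne_zero hβ fun k => ?_
    have hk : ‖β k‖ ≤ σ := hβ.le_tsum k fun j _ => norm_nonneg _
    calc ‖β k‖ * ‖z‖ ≤ σ * ρ₀ := mul_le_mul hk hz.le (norm_nonneg _) hσ0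
      _ < 1 := by rw [hρ₀, ← div_eq_mul_inv, div_lt_one (by linarith)]; linarith
  set g : ℂ → ℂ := fun z => (∏' k, (1 - β k * z))⁻¹ with hg
  have hgd : DifferentiableOn ℂ g (ball (0 : ℂ) ρ₀) := fun z hz =>
    (((differentiable_tprod_one_sub hβ) z).inv (hne z (mem_ball_zero_iff.1 hz))).differentiableWithinAt
  -- Taylor series of `g` and of `F(-z)`
  set t : ℕ → ℂ := fun n => iteratedDeriv n g 0 / n ! with ht
  have hgs : ∀ z : ℂ, ‖z‖ < ρ₀ → HasSum (fun n => t n * z ^ n) (g z) := fun z hz =>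
    hasSum_taylorCoeff_of_differentiableOn hgd hz
  set F : ℂ → ℂ := fun z => ∏' k, (1 + β k * z) with hF
  have hFd : Differentiable ℂ F := differentiable_tprod_one_add hβ
  set a' : ℕ → ℂ := fun n => (-1) ^ n * (a n : ℂ) with ha'
  have hFs : ∀ z : ℂ, HasSum (fun n => a' n * z ^ n) (F (-z)) := by
    intro z
    have := hasSum_taylorCoeff_of_differentiableOn (hFd.differentiableOn (s := ball (0 : ℂ) (‖z‖ + 1)))
      (z := -z) (by rw [norm_neg]; linarith)
    refine this.congr_fun fun n => ?_
    show a' n * z ^ n = iteratedDeriv n F 0 / n ! * (-z) ^ n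
    rw [ha n, ha', neg_pow]; ring
  have hFQ : ∀ z : ℂ, F (-z) = ∏' k, (1 - β k * z) := fun z =>
    tprod_congr fun k => by ring
  -- the Cauchy product `F(-z) g(z) = 1` on `‖z‖ < ρ₀`
  have hconv : ∀ m, ∑ k ∈ Finset.range (m + 1), a' k * t (m - k) = if m = 0 then 1 else 0 := by
    have hone : ∀ z : ℂ, ‖z‖ < ρ₀ →
        HasSum (fun m => (∑ k ∈ Finset.range (m + 1), a' k * t (m - k)) * z ^ m) ((fun _ => (1 : ℂ)) z) := by
      intro z hz
      have hf : Summable fun n => ‖a' n * z ^ n‖ :=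
        summable_norm_of_hasSum (r := ‖z‖ + 1) (by positivity) (fun w _ => hFs w) (by linarith)
      have hg' : Summable fun n => ‖t n * z ^ n‖ := summable_norm_of_hasSum hρ₀0 hgs hz
      have H := hasSum_sum_range_mul_of_summable_norm hf hg'
      rw [(hFs z).tsum_eq, (hgs z hz).tsum_eq, hFQ, mul_inv_cancel₀ (hne z hz)] at H
      refine H.congr_fun fun m => ?_
      rw [Finset.sum_mul]
      refine Finset.sum_congr rfl fun k hk => ?_
      rw [Finset.mem_range] at hk
      rw [← pow_mul_pow_sub z (Nat.le_of_lt_succ hk)]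
      ring
    intro m
    have := taylorCoeff_eq_of_hasSum hρ₀0 hone m
    rw [← this, iteratedDeriv_const]
    split_ifs with hm
    · rw [hm]; simp
    · simp
  -- `negRecipSeq a` satisfies the same recursion
  have ha0 : a 0 = 1 := by
    have := ha 0
    simp only [iteratedDeriv_zero, Nat.factorial_zero, Nat.cast_one, div_one] at this
    rw [show F 0 = 1 by simp [hF]] at this
    exact_mod_cast this.symm
  have hrec : ∀ m, ∑ k ∈ Finset.range (m + 1), a' k * (negRecipSeq a (m - k) : ℂ) =
      if m = 0 then 1 else 0 := by
    intro m
    have h := sum_mul_recipSeq (a := a) (by rw [ha0]; exact one_ne_zero) m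
    have h' : ∑ k ∈ Finset.range (m + 1), a' k * (negRecipSeq a (m - k) : ℂ) =
        (-1) ^ m * ((∑ k ∈ Finset.range (m + 1), a k * recipSeq a (m - k) : ℝ) : ℂ) := by
      push_cast
      rw [Finset.mul_sum]
      refine Finset.sum_congr rfl fun k hk => ?_
      rw [Finset.mem_range] at hk
      simp only [ha', negRecipSeq]
      push_cast
      rw [show ((-1 : ℂ)) ^ m = (-1) ^ k * (-1) ^ (m - k) by rw [← pow_add]; congr 1; omega]
      ring
    rw [h', h]
    split_ifs with hm
    · rw [hm]; simp
    · simp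
  have a'0 : a' 0 = 1 := by simp [ha', ha0]
  have := conv_unique (y := fun j => (negRecipSeq a j : ℂ)) a'0 hconv hrec
  exact congrFun this n

/-! ### C9. The induction: all `βₙ` are real and non-negative -/

/-- **PF Taylor coefficients force the zeros onto the negative axis** (product form). Let
`F(z) = ∏ (1 + βₙ z)` with `Σ ‖βₙ‖ < ∞`, and suppose the Taylor sequence `a` of `F` at `0` is real
and a Pólya frequency sequence. Then every `βₙ` is real and `≥ 0`, i.e. `F ∈ L-P⁺` and all zeros
`-1/βₙ` of `F` are negative. This is the "`⇒`" half of the Aissen–Schoenberg–Whitney–Edrei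
theorem for entire functions of genus `0` [Aissen–Edrei–Schoenberg–Whitney 1951, Thm. 5 (entire
case) and Thm. 2 (zeros negative, poles positive); Aissen–Schoenberg–Whitney 1952], proved here by
the elementary deflation argument of Parts A–C (no Nevanlinna theory: Edrei's contribution, the
form of the zero-free factor [AESW 1951, Thm. 3], is not needed in genus `0`).
[cite: AissenEdreiSchoenbergWhitney1951, Thm. 5] -/
theorem nonneg_of_pf_taylor_tprod {β : ℕ → ℂ} (hβ : Summable fun n => ‖β n‖) {a : ℕ → ℝ}
    (hpf : IsPolyaFrequencySeq a)
    (ha : ∀ n, iteratedDeriv n (fun z => ∏' k, (1 + β k * z)) 0 / n ! = a n) (m : ℕ) :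
    (β m).im = 0 ∧ 0 ≤ (β m).re := by
  classical
  by_contra hbad
  have hβm : β m ≠ 0 := by
    intro h; rw [h] at hbad; simp at hbad
  -- `a 0 = 1`
  have ha0 : a 0 = 1 := by
    have := ha 0
    simp only [iteratedDeriv_zero, Nat.factorial_zero, Nat.cast_one, div_one, mul_zero,
      add_zero, tprod_one] at this
    exact_mod_cast this.symm
  -- the stage predicate
  let γS : Finset ℕ → ℕ → ℂ := fun S n => if n ∈ S then 0 else β n
  have hγS_norm : ∀ S n, ‖γS S n‖ ≤ ‖β n‖ := fun S n => by
    simp only [γS]; split_ifs <;> simp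
  have hγS_sum : ∀ S, Summable fun n => ‖γS S n‖ := fun S =>
    Summable.of_nonneg_of_le (fun n => norm_nonneg _) (hγS_norm S) hβ
  have hγS_insert : ∀ S n₀, Function.update (γS S) n₀ 0 = γS (insert n₀ S) := by
    intro S n₀
    funext n
    by_cases hn : n = n₀
    · rw [hn, Function.update_self]; simp [γS]
    · rw [Function.update_of_ne hn]; simp [γS, hn]
  let Stage : Finset ℕ → Prop := fun S => ∃ b : ℕ → ℝ, IsColumnPF b ∧ b 0 = 1 ∧
    ∀ n, iteratedDeriv n (fun z => (∏' k, (1 - γS S k * z))⁻¹) 0 / n ! = b n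
  -- the finite set of "large" indices
  obtain ⟨N, hN⟩ : ∃ N, ∀ n, N ≤ n → ‖β n‖ < ‖β m‖ := by
    have ht : Tendsto (fun n => ‖β n‖) atTop (𝓝 0) := by simpa using hβ.tendsto_atTop_zero
    exact eventually_atTop.1 (ht.eventually (gt_mem_nhds (norm_pos_iff.2 hβm)))
  set T : Finset ℕ := (Finset.range N).filter fun n => ‖β m‖ ≤ ‖β n‖ with hT
  have hTmem : ∀ n, ‖β m‖ ≤ ‖β n‖ → n ∈ T := fun n hn => by
    rw [hT, Finset.mem_filter, Finset.mem_range]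
    exact ⟨not_le.1 fun h => absurd (hN n h) (not_lt.2 hn), hn⟩
  -- the induction
  have key : ∀ k : ℕ, ∃ S : Finset ℕ, S.card = k ∧ S ⊆ T ∧ m ∉ S ∧ Stage S := by
    intro k
    induction k with
    | zero =>
      refine ⟨∅, Finset.card_empty, Finset.empty_subset _, Finset.notMem_empty _, ?_⟩
      refine ⟨negRecipSeq a, fun p r j hr => toeplitzMinor_negRecipSeq_consecutive hpf ha0 r hr j,
        negRecipSeq_zero ha0, fun n => ?_⟩
      have : γS ∅ = β := funext fun n => by simp [γS]
      rw [this]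
      exact taylorCoeff_inv_eq_negRecipSeq hβ ha n
    | succ k ih =>
      obtain ⟨S, hcard, hST, hmS, b, hcol, hb0, hb⟩ := ih
      have hγm : γS S m ≠ 0 := by simpa [γS, hmS] using hβm
      obtain ⟨n₁, hn₁, hmax⟩ := exists_norm_max (hγS_sum S) hγm
      obtain ⟨n₀, hn₀, hcol', hb0', hb'⟩ := deflation_step (hγS_sum S) hmax hn₁ hcol hb0 hb
      have hM : 0 < ‖γS S n₁‖ := norm_pos_iff.2 hn₁
      have hn₀S : n₀ ∉ S := by
        intro h
        have : γS S n₀ = 0 := by simp [γS, h]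
        rw [this] at hn₀
        exact hM.ne' (by exact_mod_cast hn₀.symm)
      have hβn₀ : β n₀ = (‖γS S n₁‖ : ℂ) := by rw [← hn₀]; simp [γS, hn₀S]
      have hn₀m : n₀ ≠ m := by
        intro h
        apply hbad
        rw [← h, hβn₀]
        exact ⟨by simp, by simp⟩
      have hn₀T : n₀ ∈ T := hTmem n₀ (by
        rw [hβn₀, Complex.norm_real, Real.norm_of_nonneg hM.le]
        have := hmax m
        simpa [γS, hmS] using this)
      refine ⟨insert n₀ S, by rw [Finset.card_insert_of_notMem hn₀S, hcard],
        Finset.insert_subset hn₀T hST, by simp [hn₀m.symm, hmS], ?_⟩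
      refine ⟨_, hcol', hb0', fun n => ?_⟩
      rw [← hγS_insert]
      exact hb' n
  obtain ⟨S, hcard, hST, -, -⟩ := key (T.card + 1)
  have := Finset.card_le_card hST
  omega

/-! ### C10. Assembly: `pf_taylor_iff_zeros_of_order_lt_one` from Hadamard's factorisation alone -/

/-- **PF ⇒ zeros real `≤ 0`, from Hadamard.** For an entire `F` of order `< 1` with real Taylor
coefficients, `F(0) > 0` and PF Taylor sequence, all zeros of `F` are real and `≤ 0`: Hadamard
(`Literature.Analysis.Complex.hadamard_genus_zero`) writes `F = F(0) ∏ (1 + βₙ z)`, and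
`nonneg_of_pf_taylor_tprod` gives `βₙ ≥ 0`. [Karlin 1968, Ch. 8, Thm. 5.3 (⇒);
Aissen–Edrei–Schoenberg–Whitney 1951, Thm. 5; Katkova 2006, §1 Thm. C (⇒)]
[cite: Katkova2006, §1 Thm. C] -/
theorem zeros_nonpos_of_pf_taylor (hH : Literature.Analysis.Complex.hadamard_genus_zero) {F : ℂ → ℂ}
    (hF : IsEntireOfOrderLtOne F) (hreal : ∀ n : ℕ, (iteratedDeriv n F 0).im = 0)
    (h0 : 0 < (F 0).re) (hpf : IsPolyaFrequencySeq fun n => (iteratedDeriv n F 0).re / (n ! : ℝ)) :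
    ∀ z : ℂ, F z = 0 → z.im = 0 ∧ z.re ≤ 0 := by
  obtain ⟨hdiff, ρ, C, hρ, hbound⟩ := hF
  have hF0 : F 0 ≠ 0 := fun h => by rw [h] at h0; simp at h0
  obtain ⟨b, hb, hprod⟩ := hH F ρ C hdiff hρ hbound hF0
  -- `β = -b`, `G = F / F(0) = ∏ (1 + βₙ z)`
  set β : ℕ → ℂ := fun n => -b n with hβ
  have hβs : Summable fun n => ‖β n‖ := by simpa [hβ] using hb
  have hG : ∀ z, F z / F 0 = ∏' k, (1 + β k * z) := fun z => by
    rw [← (hprod z).tprod_eq]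
    exact tprod_congr fun k => by simp [hβ]; ring
  -- the Taylor sequence of `G`
  set a : ℕ → ℝ := fun n => (F 0).re⁻¹ * ((iteratedDeriv n F 0).re / (n ! : ℝ)) with ha
  have hF0re : F 0 = ((F 0).re : ℂ) := by
    apply Complex.ext
    · simp
    · simpa using hreal 0
  have hpf' : IsPolyaFrequencySeq a := hpf.smul (inv_nonneg.2 h0.le)
  have haG : ∀ n, iteratedDeriv n (fun z => ∏' k, (1 + β k * z)) 0 / n ! = a n := by
    have hsum : ∀ z : ℂ, ‖z‖ < 1 → HasSum (fun n => (a n : ℂ) * z ^ n) (∏' k, (1 + β k * z)) := by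
      intro z hz
      have h1 := hasSum_taylorCoeff_of_differentiableOn
        (hdiff.differentiableOn (s := ball (0 : ℂ) 1)) hz
      have h2 := h1.div_const (F 0)
      rw [hG z] at h2
      refine h2.congr_fun fun n => ?_
      have hre : ((iteratedDeriv n F 0).re : ℂ) = iteratedDeriv n F 0 := by
        apply Complex.ext
        · simp
        · simp [hreal n]
      show (a n : ℂ) * z ^ n = iteratedDeriv n F 0 / n ! * z ^ n / F 0
      rw [ha]; push_cast; rw [hre]
      conv_rhs => rw [hF0re]
      have : ((F 0).re : ℂ) ≠ 0 := by rw [← hF0re]; exact hF0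
      field_simp
    exact taylorCoeff_eq_of_hasSum one_pos hsum
  have hnonneg := nonneg_of_pf_taylor_tprod hβs hpf' haG
  -- zeros
  intro z hz
  have hGz : ∏' k, (1 + β k * z) = 0 := by rw [← hG z, hz, zero_div]
  obtain ⟨k, hk⟩ := exists_factor_eq_zero_of_tprod_eq_zero hβs hGz
  obtain ⟨him, hre⟩ := hnonneg k
  have hβk : β k ≠ 0 := by
    intro h; rw [h] at hk; simp at hk
  have hβre : 0 < (β k).re := by
    rcases hre.lt_or_eq with h | h
    · exact h
    · exfalso; apply hβk; apply Complex.ext <;> simp [← h, him]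
  -- `z = -1/βₖ` with `βₖ > 0`
  have hzeq : z = -((β k).re : ℂ)⁻¹ := by
    have hβk' : β k = ((β k).re : ℂ) := by apply Complex.ext <;> simp [him]
    have h1 : β k * z = -1 := by linear_combination hk
    rw [hβk'] at h1
    have h2 : ((β k).re : ℂ) ≠ 0 := by exact_mod_cast hβre.ne'
    field_simp
    linear_combination h1
  rw [hzeq]
  constructor
  · simp
  · simp only [Complex.neg_re, ← Complex.ofReal_inv, Complex.ofReal_re, Left.neg_nonpos_iff]
    exact inv_nonneg.2 hβre.le

/-- **`pf_taylor_iff_zeros_of_order_lt_one` from Hadamard's genus-zero factorisation alone**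
(no appeal to the full ASWE representation `aswe_edrei`): the `⇒` half is
`zeros_nonpos_of_pf_taylor`, the `⇐` half is `isPolyaFrequencySeq_taylor_of_zeros`.
[Karlin 1968, Ch. 8, Thm. 5.3; Katkova 2006, §1 Thm. C; AESW 1951, Thm. 5]
[cite: Katkova2006, §1 Thm. C] -/
theorem pf_taylor_iff_zeros_of_order_lt_one_of_hadamard (hH : Literature.Analysis.Complex.hadamard_genus_zero) :
    pf_taylor_iff_zeros_of_order_lt_one := fun _ hF hreal h0 =>
  ⟨fun hpf => zeros_nonpos_of_pf_taylor hH hF hreal h0 hpf,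
    fun hz => isPolyaFrequencySeq_taylor_of_zeros hH hF hreal h0 hz⟩

end Literature.Analysis.TotalPositivity
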